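import Summits.AtomisticToContinuum.Crystallization.Theorems.ChargedEnergyGapChartDial

/-!
# `ChargedEnergyGap` · the CHART DIAL, part B (§4 exact split, §5 dial, §P pins) — decomp-a2c lens-3 g36 node, continued

Continuation of `…Theorems.ChargedEnergyGapChartDial` (part A: §1 chart predicate and counts, §2 pieces, §3 counting, §0 port of negative
side VII, the translation `chargedEnergyGap_iff_periodicPricing`).  MECHANICAL SPLIT of the lens-3 g36 node file (sha256 25b651b9ac39d88e…,
600 l) at the §3/§4 boundary for the gate's 400-line rule (decomp-a2c hand-1 g18, landing owner); bodies byte-identical, same namespace and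
`open`s; eight one-line docstrings added for the docstring lint (no statement touched).  See part A's module docstring for the node.
-/

noncomputable section

open Literature.MathematicalPhysics.StatisticalMechanics
open Literature.Geometry.DiscreteGeometry
open Summit.AtomisticToContinuum.Crystallization.Theses.PricedLinkCensus
open Summit.AtomisticToContinuum.Crystallization.Theorems.ChargedEnergyGapNegative
namespace Summit.AtomisticToContinuum.Crystallization.Theorems.ChargedEnergyGapChartDial

/-! ## §4 The exact split (the node's `closes` and its two weakness certificates) -/

/-- **GLUE** (weighted sum): the two pieces give the periodic pricing with
`κ = κ₁κ₂/(κ₁ + κ₂ + C)`. -/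
theorem periodicPricing_of_pieces {θ : ℝ} (hG : GrossChargeGap θ) (hP : ChartedChargePricing θ) :
    ∃ κ : ℝ, 0 < κ ∧ PeriodicPricing (1 / 100) κ := by
  obtain ⟨κ₁, hκ₁, hG⟩ := hG
  obtain ⟨κ₂, C, hκ₂, hC, hP⟩ := hP
  have hS : 0 < κ₁ + κ₂ + C := by linarith
  refine ⟨κ₁ * κ₂ / (κ₁ + κ₂ + C), div_pos (mul_pos hκ₁ hκ₂) hS, fun Q => ?_⟩
  have h1 := hG Q
  have h2 := hP Q
  have hsplit : (motifCharged (1 / 100) Q : ℝ) =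
      (motifChargedGross θ Q : ℝ) + (motifChargedCharted θ Q : ℝ) := by
    exact_mod_cast motifCharged_eq_add θ Q
  have hg0 : (0 : ℝ) ≤ motifChargedGross θ Q := Nat.cast_nonneg _
  have hc0 : (0 : ℝ) ≤ motifChargedCharted θ Q := Nat.cast_nonneg _
  have hX : 0 ≤ excess Q := excess_nonneg' Q
  show κ₁ * κ₂ / (κ₁ + κ₂ + C) * (motifCharged (1 / 100) Q : ℝ) ≤
    (Q.motif.card : ℝ) * (Q.energyPerParticle lennardJones - eStar)
  rw [hsplit, div_mul_eq_mul_div, div_le_iff₀ hS]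
  have e1 : κ₁ * κ₂ * (motifChargedGross θ Q : ℝ) ≤ κ₂ * excess Q := by nlinarith
  have e2 : κ₁ * κ₂ * (motifChargedCharted θ Q : ℝ) ≤
      κ₁ * excess Q + κ₁ * C * (motifChargedGross θ Q : ℝ) := by nlinarith
  have e3 : κ₁ * C * (motifChargedGross θ Q : ℝ) ≤ C * excess Q := by nlinarith
  show κ₁ * κ₂ * ((motifChargedGross θ Q : ℝ) + (motifChargedCharted θ Q : ℝ)) ≤
    excess Q * (κ₁ + κ₂ + C)
  nlinarith

/-- **`closes` of the node**: the two pieces imply the crux (for any `θ`). -/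
theorem chargedEnergyGap_of_pieces {θ : ℝ} (hG : GrossChargeGap θ)
    (hP : ChartedChargePricing θ) : ChargedEnergyGap := by
  obtain ⟨κ, hκ, h⟩ := periodicPricing_of_pieces hG hP
  exact chargedEnergyGap_of_periodicPricing hκ h

/-- **WEAKER, piece 1**: the crux implies the gross charge gap (same `κ`; drop the charted class). -/
theorem grossChargeGap_of_chargedEnergyGap (θ : ℝ) (h : ChargedEnergyGap) : GrossChargeGap θ := by
  obtain ⟨κ, hκ, hp⟩ := chargedEnergyGap_iff_periodicPricing.1 h
  refine ⟨κ, hκ, fun Q => le_trans ?_ (hp Q)⟩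
  have : (motifChargedGross θ Q : ℝ) ≤ motifCharged (1 / 100) Q := by
    exact_mod_cast motifChargedGross_le θ Q
  exact mul_le_mul_of_nonneg_left this hκ.le

/-- **WEAKER, piece 2**: the crux implies the charted charge pricing (same `κ`, debit `C = 0`). -/
theorem chartedChargePricing_of_chargedEnergyGap (θ : ℝ) (h : ChargedEnergyGap) :
    ChartedChargePricing θ := by
  obtain ⟨κ, hκ, hp⟩ := chargedEnergyGap_iff_periodicPricing.1 h
  refine ⟨κ, 0, hκ, le_rfl, fun Q => ?_⟩
  have : (motifChargedCharted θ Q : ℝ) ≤ motifCharged (1 / 100) Q := by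
    exact_mod_cast motifChargedCharted_le θ Q
  have h' := hp Q
  calc κ * (motifChargedCharted θ Q : ℝ) ≤ κ * (motifCharged (1 / 100) Q : ℝ) :=
        mul_le_mul_of_nonneg_left this hκ.le
    _ ≤ excess Q + 0 * (motifChargedGross θ Q : ℝ) := by rw [zero_mul, add_zero]; exact h'

/-- **THE NODE**: for every tolerance `θ`, the crux is EXACTLY the conjunction of the two pieces. -/
theorem chargedEnergyGap_iff_pieces (θ : ℝ) :
    ChargedEnergyGap ↔ GrossChargeGap θ ∧ ChartedChargePricing θ :=
  ⟨fun h => ⟨grossChargeGap_of_chargedEnergyGap θ h, chartedChargePricing_of_chargedEnergyGap θ h⟩,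
    fun h => chargedEnergyGap_of_pieces h.1 h.2⟩

/-- The same with the TRANSLATION spelled out: periodic pricing ⟺ the two pieces. -/
theorem periodicPricing_iff_pieces (θ : ℝ) :
    (∃ κ : ℝ, 0 < κ ∧ PeriodicPricing (1 / 100) κ) ↔ GrossChargeGap θ ∧ ChartedChargePricing θ := by
  rw [← chargedEnergyGap_iff_periodicPricing]; exact chargedEnergyGap_iff_pieces θ

/-! ## §5 The dial: monotonicity in `θ`, the end `θ < 0`, and the dictionary remark -/

/-- `ChartedAt` is monotone in the tolerance `θ`. [this file, g36] -/
theorem chartedAt_mono {θ θ' : ℝ} (h : θ ≤ θ') {Q : PeriodicConfiguration 3} {p : Q.points}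
    (hc : ChartedAt θ Q p) : ChartedAt θ' Q p := by
  obtain ⟨T, hT, hclose⟩ := hc
  refine ⟨T, hT, ?_⟩
  rcases hclose with ⟨A, hA⟩ | ⟨A, hA⟩
  · exact Or.inl ⟨A, hA.mono h⟩
  · exact Or.inr ⟨A, hA.mono h⟩

/-- the gross charged count is antitone in `θ`. [this file, g36] -/
theorem motifChargedGross_anti {θ θ' : ℝ} (h : θ ≤ θ') (Q : PeriodicConfiguration 3) :
    motifChargedGross θ' Q ≤ motifChargedGross θ Q :=
  Nat.card_le_card_of_injective
    (fun x : {x : Q.motif // Charged Q x ∧ ¬ ChartedAt θ' Q (pt Q x)} =>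
      (⟨x.1, x.2.1, fun hc => x.2.2 (chartedAt_mono h hc)⟩ :
        {x : Q.motif // Charged Q x ∧ ¬ ChartedAt θ Q (pt Q x)}))
    (fun x y hxy => Subtype.ext (by have h' := congrArg Subtype.val hxy; simpa using h'))

/-- the charted charged count is monotone in `θ`. [this file, g36] -/
theorem motifChargedCharted_mono {θ θ' : ℝ} (h : θ ≤ θ') (Q : PeriodicConfiguration 3) :
    motifChargedCharted θ Q ≤ motifChargedCharted θ' Q :=
  Nat.card_le_card_of_injective
    (fun x : {x : Q.motif // Charged Q x ∧ ChartedAt θ Q (pt Q x)} =>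
      (⟨x.1, x.2.1, chartedAt_mono h x.2.2⟩ : {x : Q.motif // Charged Q x ∧ ChartedAt θ' Q (pt Q x)}))
    (fun x y hxy => Subtype.ext (by have h' := congrArg Subtype.val hxy; simpa using h'))

/-- DIAL, gross side: pricing the gross class at a tight tolerance prices it at any looser one. -/
theorem grossChargeGap_mono {θ θ' : ℝ} (h : θ ≤ θ') (hG : GrossChargeGap θ) : GrossChargeGap θ' := by
  obtain ⟨κ, hκ, hG⟩ := hG
  refine ⟨κ, hκ, fun Q => le_trans ?_ (hG Q)⟩
  have : (motifChargedGross θ' Q : ℝ) ≤ motifChargedGross θ Q := by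
    exact_mod_cast motifChargedGross_anti h Q
  exact mul_le_mul_of_nonneg_left this hκ.le

/-- DIAL, charted side: pricing the charted class at a loose tolerance prices it at any tighter one. -/
theorem chartedChargePricing_anti {θ θ' : ℝ} (h : θ ≤ θ') (hP : ChartedChargePricing θ') :
    ChartedChargePricing θ := by
  obtain ⟨κ, C, hκ, hC, hP⟩ := hP
  refine ⟨κ, C, hκ, hC, fun Q => ?_⟩
  have h1 : (motifChargedCharted θ Q : ℝ) ≤ motifChargedCharted θ' Q := by
    exact_mod_cast motifChargedCharted_mono h Q
  have h2 : (motifChargedGross θ' Q : ℝ) ≤ motifChargedGross θ Q := by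
    exact_mod_cast motifChargedGross_anti h Q
  calc κ * (motifChargedCharted θ Q : ℝ) ≤ κ * (motifChargedCharted θ' Q : ℝ) :=
        mul_le_mul_of_nonneg_left h1 hκ.le
    _ ≤ excess Q + C * (motifChargedGross θ' Q : ℝ) := hP Q
    _ ≤ excess Q + C * (motifChargedGross θ Q : ℝ) := by
        have := mul_le_mul_of_nonneg_left h2 hC; linarith

/-- At a negative tolerance nothing is charted (a pattern-close shell has twelve points, each
matched within `θ < 0 ≤ dist`). -/
theorem not_chartedAt_of_neg {θ : ℝ} (hθ : θ < 0) (Q : PeriodicConfiguration 3) (p : Q.points) :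
    ¬ ChartedAt θ Q p := by
  rintro ⟨T, -, hclose⟩
  have hcard : T.card = 12 := card_eq_twelve_of_shellCloseTo hclose
  obtain ⟨t, ht⟩ : T.Nonempty := by
    rw [← Finset.card_pos, hcard]; norm_num
  rcases hclose with ⟨A, e, he⟩ | ⟨A, e, he⟩
  · exact absurd ((dist_nonneg.trans (he ⟨t, ht⟩)).trans_lt hθ) (lt_irrefl 0)
  · exact absurd ((dist_nonneg.trans (he ⟨t, ht⟩)).trans_lt hθ) (lt_irrefl 0)

/-- for `θ < 0` no site is charted: the charted charged count vanishes. [this file, g36] -/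
theorem motifChargedCharted_eq_zero_of_neg {θ : ℝ} (hθ : θ < 0) (Q : PeriodicConfiguration 3) :
    motifChargedCharted θ Q = 0 := by
  unfold motifChargedCharted
  haveI : IsEmpty {x : Q.motif // Charged Q x ∧ ChartedAt θ Q (pt Q x)} :=
    ⟨fun x => not_chartedAt_of_neg hθ Q _ x.2.2⟩
  exact Nat.card_of_isEmpty

/-- DIAL END `θ < 0`: the charted piece is a theorem … -/
theorem chartedChargePricing_of_neg {θ : ℝ} (hθ : θ < 0) : ChartedChargePricing θ :=
  ⟨1, 0, one_pos, le_rfl, fun Q => by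
    rw [motifChargedCharted_eq_zero_of_neg hθ Q, Nat.cast_zero, mul_zero, zero_mul, add_zero]
    exact excess_nonneg' Q⟩

/-- … and the gross piece IS the crux: the dial starts at the crux itself. -/
theorem grossChargeGap_iff_chargedEnergyGap_of_neg {θ : ℝ} (hθ : θ < 0) :
    GrossChargeGap θ ↔ ChargedEnergyGap :=
  ⟨fun h => chargedEnergyGap_of_pieces h (chartedChargePricing_of_neg hθ),
    grossChargeGap_of_chargedEnergyGap θ⟩

/-- The gross gap (all uncharted sites) implies the gross CHARGE gap outright. -/
theorem grossChargeGap_of_grossGap {θ : ℝ} (h : GrossGap θ) : GrossChargeGap θ := by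
  obtain ⟨κ, hκ, h⟩ := h
  refine ⟨κ, hκ, fun Q => le_trans ?_ (h Q)⟩
  have : (motifChargedGross θ Q : ℝ) ≤ motifGross θ Q := by
    exact_mod_cast motifChargedGross_le_motifGross θ Q
  exact mul_le_mul_of_nonneg_left this hκ.le

/-- Under the dictionary, uncharted sites are charged, so the two gross counts agree. -/
theorem motifGross_eq_of_dict {θ : ℝ} (hD : ChargeFreeCharted θ) (Q : PeriodicConfiguration 3) :
    motifGross θ Q = motifChargedGross θ Q :=
  Nat.card_congr (Equiv.subtypeEquivRight fun x =>
    ⟨fun hx => ⟨fun hcf => hx (hD Q (pt Q x) hcf), hx⟩, fun hx => hx.2⟩)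

/-- DICTIONARY REMARK: under `ChargeFreeCharted θ` the gross charge gap is the full gross gap. -/
theorem grossGap_iff_grossChargeGap_of_dict {θ : ℝ} (hD : ChargeFreeCharted θ) :
    GrossGap θ ↔ GrossChargeGap θ := by
  refine ⟨grossChargeGap_of_grossGap, fun ⟨κ, hκ, h⟩ => ⟨κ, hκ, fun Q => ?_⟩⟩
  rw [motifGross_eq_of_dict hD Q]; exact h Q

/-! ## §P Pins — the two pieces over `Mathlib + Literature` and `e* = ⨅ e(Q)` (for registering
them as items; `Iff.rfl`). -/

/-- PIN: `GrossChargeGap θ` unfolded over `Mathlib + Literature` and `e* = ⨅ e(Q)` (registration form). [this file, g36] -/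
theorem grossChargeGap_pin (θ : ℝ) : GrossChargeGap θ ↔
    ∃ κ : ℝ, 0 < κ ∧ ∀ Q : PeriodicConfiguration 3,
      κ * (Nat.card {x : Q.motif //
          ¬ IsChargeFree (1 / 100) (Subtype.val : Q.points → E3) ⟨x.1, Q.mem_points_of_mem_motif x.2⟩ ∧
          ¬ ∃ T : Finset E3, (↑T : Set E3) =
              (fun q : E3 => (nearestDist (Subtype.val : Q.points → E3)
                  ⟨x.1, Q.mem_points_of_mem_motif x.2⟩)⁻¹ • (q - x.1)) ''
                {q : E3 | q ∈ Q.points ∧ q ≠ x.1 ∧ dist x.1 q ≤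
                  6 / 5 * nearestDist (Subtype.val : Q.points → E3) ⟨x.1, Q.mem_points_of_mem_motif x.2⟩} ∧
            (ShellCloseTo θ T fccKissingPattern ∨ ShellCloseTo θ T hcpKissingPattern)} : ℝ) ≤
        (Q.motif.card : ℝ) * (Q.energyPerParticle lennardJones -
          ⨅ Q' : PeriodicConfiguration 3, Q'.energyPerParticle lennardJones) :=
  Iff.rfl

/-- PIN: `ChartedChargePricing θ` unfolded over `Mathlib + Literature` and `e* = ⨅ e(Q)` (registration form). [this file, g36] -/
theorem chartedChargePricing_pin (θ : ℝ) : ChartedChargePricing θ ↔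
    ∃ κ C : ℝ, 0 < κ ∧ 0 ≤ C ∧ ∀ Q : PeriodicConfiguration 3,
      κ * (Nat.card {x : Q.motif //
          ¬ IsChargeFree (1 / 100) (Subtype.val : Q.points → E3) ⟨x.1, Q.mem_points_of_mem_motif x.2⟩ ∧
          ∃ T : Finset E3, (↑T : Set E3) =
              (fun q : E3 => (nearestDist (Subtype.val : Q.points → E3)
                  ⟨x.1, Q.mem_points_of_mem_motif x.2⟩)⁻¹ • (q - x.1)) ''
                {q : E3 | q ∈ Q.points ∧ q ≠ x.1 ∧ dist x.1 q ≤
                  6 / 5 * nearestDist (Subtype.val : Q.points → E3) ⟨x.1, Q.mem_points_of_mem_motif x.2⟩} ∧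
            (ShellCloseTo θ T fccKissingPattern ∨ ShellCloseTo θ T hcpKissingPattern)} : ℝ) ≤
        (Q.motif.card : ℝ) * (Q.energyPerParticle lennardJones -
          ⨅ Q' : PeriodicConfiguration 3, Q'.energyPerParticle lennardJones) +
        C * (Nat.card {x : Q.motif //
          ¬ IsChargeFree (1 / 100) (Subtype.val : Q.points → E3) ⟨x.1, Q.mem_points_of_mem_motif x.2⟩ ∧
          ¬ ∃ T : Finset E3, (↑T : Set E3) =
              (fun q : E3 => (nearestDist (Subtype.val : Q.points → E3)
                  ⟨x.1, Q.mem_points_of_mem_motif x.2⟩)⁻¹ • (q - x.1)) ''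
                {q : E3 | q ∈ Q.points ∧ q ≠ x.1 ∧ dist x.1 q ≤
                  6 / 5 * nearestDist (Subtype.val : Q.points → E3) ⟨x.1, Q.mem_points_of_mem_motif x.2⟩} ∧
            (ShellCloseTo θ T fccKissingPattern ∨ ShellCloseTo θ T hcpKissingPattern)} : ℝ) :=
  Iff.rfl

end Summit.AtomisticToContinuum.Crystallization.Theorems.ChargedEnergyGapChartDial

end
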